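import Literature.NumberTheory.Automorphic.TorusEigencoordinates
import Literature.NumberTheory.Automorphic.ParallelWeightTensorEmbedding
import Literature.Algebra.Homology.PairMapFiltration
import Literature.Algebra.Homology.CoinducedConjugation
import Mathlib.NumberTheory.NumberField.InfinitePlace.Embeddings
import HarnessLib

/-!
# Torus eigencharacters on the cohomology of the unipotent arithmetic groups are algebraic

Topic `NumberTheory/Automorphic`; namespace `Literature.NumberTheory.Automorphic.ParallelWeight`.
Theorems (and auxiliary definitions with bodies); no named fact.

Let `F` be a quadratic field, `E ⊇ F` algebraically closed of characteristic `0` (two embeddings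
`τ₁ ≠ τ₂ : F → E`), `Λ = Γ_{x₀} ≤ B(F)` the stabiliser of a boundary point at a neat level — a free
abelian group of rank two of unipotent matrices `n(β)` (`BorelStabilizerCohomology`) — and
`V_wt = ⨂_τ V_wt(E) ∘ GL₂(τ)` the parallel-weight coefficients.  For diagonal `s ∈ B(F)` with
`s⁻¹ Λ s ⊆ Λ` the pair maps `Φ_s = H^q(c_s, ρ(s))` (`c_s(λ) = s⁻¹ λ s`) act on `H^q(Λ, V_wt)`.

* `scalarFiltered_torus` — for any family `x ↦ s_x` of such elements, `H^q(Λ, V_wt)` has a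
  `Φ`-stable filtration on whose graded pieces every `Φ_{s_x}` acts by an **algebraic character**
  `χ(x) = χ_I(s_x) · ∏_τ τ(b_x/a_x)^{p_τ}` (`s_x = diag(a_x, b_x)`, `χ_I` the torus weights of the
  ambient tensor representation, `p_τ ∈ {0, 1}`);
* `exists_torus_eigencharacter` — hence the eigencharacter of a common eigenvector of the `Φ_{s_x}`
  is such an algebraic character.

Proof: `V_wt ↪ 𝕋` (`ParallelWeightTensorEmbedding`); the dévissage
`Literature.Algebra.Homology.scalarFiltered_sub_of_ambient` along the standard flag of `𝕋` (unipotent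
`Λ` acts unitriangularly, the torus diagonally); on the graded pieces `H^q(Λ, E)` the characters are
`1`, `τᵢ(b/a)`, `τ₁τ₂(b/a)` (`RankTwoLatticeCohomologyCharacters`, eigen-coordinates
`θᵢ(n(β)) = τᵢ(β)`).  This is the computation of [Harder1987, §2, (2.4)–(2.7)] of the torus action on
`H^•(Γ ∩ U, M) = H^•(𝔲, M)` (van Est / Kostant), here carried out by dévissage instead of Lie algebra
cohomology.

## References

* G. Harder, *Eisenstein cohomology of arithmetic groups. The case GL₂*, Invent. Math. 89 (1987), §2.
  [Harder1987]
-/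

noncomputable section

open scoped NumberField TensorProduct
open IsDedekindDomain CategoryTheory Literature.LinearAlgebra Literature.Algebra.Homology
  Literature.NumberTheory.DiophantineGeometry

namespace Literature.NumberTheory.Automorphic.ParallelWeight

section Lattice

open BigHeckeGLn GLnCohomology

variable {F : Type} [Field F] [NumberField F] {E : Type} [Field E]
  {𝔫 : Ideal (𝓞 F)}
  (hneat : ∀ a : F, (∀ v : HeightOneSpectrum (𝓞 F), v.valuation F a ≤ 1) →
    (∀ v : HeightOneSpectrum (𝓞 F), v.valuation F a⁻¹ ≤ 1) →
    (∀ v : HeightOneSpectrum (𝓞 F), v.valuation F (a - 1) ≤ idealRadius F v 𝔫) → a = 1)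
  (t : Fin 2 → (FiniteAdeleRing (𝓞 F) F)ˣ) {c : FiniteAdelicGL 2 F}
  (hc : c ∈ glFiniteIntegralLevel 2 F)

include hneat hc in
/-- `β(c_s γ) = β(γ) · b / a` for the conjugation `c_s = subgroupConj Λ s` by a diagonal `s`
(`TorusEigencoordinates.urEntry_conj`). [cite: Harder1987, §2] -/
theorem urEntry_subgroupConj (s : borel F) (hs01 : ((s : GL (Fin 2) F) : Matrix (Fin 2) (Fin 2) F) 0 1 = 0)
    (hs : ∀ γ ∈ borelStabilizer 𝔫 t c, s⁻¹ * γ * s ∈ borelStabilizer 𝔫 t c) (γ : borelStabilizer 𝔫 t c) :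
    urEntry t (subgroupConj (borelStabilizer 𝔫 t c) s hs γ) =
      urEntry t γ * (((s : GL (Fin 2) F) : Matrix (Fin 2) (Fin 2) F) 1 1 /
        ((s : GL (Fin 2) F) : Matrix (Fin 2) (Fin 2) F) 0 0) :=
  urEntry_conj hneat t hc s hs01 γ (hs _ γ.2)

include hneat hc in
/-- `θ_τ ∘ c_s = τ(b/a) · θ_τ`. [cite: Harder1987, §2] -/
theorem thetaChar_subgroupConj (τ : F →+* E) (s : borel F)
    (hs01 : ((s : GL (Fin 2) F) : Matrix (Fin 2) (Fin 2) F) 0 1 = 0)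
    (hs : ∀ γ ∈ borelStabilizer 𝔫 t c, s⁻¹ * γ * s ∈ borelStabilizer 𝔫 t c) (γ : borelStabilizer 𝔫 t c) :
    thetaChar hneat t hc τ (Additive.ofMul (subgroupConj (borelStabilizer 𝔫 t c) s hs γ)) =
      τ (((s : GL (Fin 2) F) : Matrix (Fin 2) (Fin 2) F) 1 1 / ((s : GL (Fin 2) F) : Matrix (Fin 2) (Fin 2) F) 0 0) *
        thetaChar hneat t hc τ (Additive.ofMul γ) := by
  rw [thetaChar_apply, thetaChar_apply, urEntry_subgroupConj hneat t hc s hs01 hs γ, map_mul, mul_comm]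

end Lattice

/-! ### The torus operators on `H^q(Λ, V_wt)` and their eigencharacters -/

section Torus

open BigHeckeGLn GLnCohomology

variable {F : Type} [Field F] [NumberField F] (E : Type) [Field E] [CharZero E] [IsAlgClosed E]
  (wt : Fin 2 → ℤ) {𝔫 : Ideal (𝓞 F)}
  (hneat : ∀ a : F, (∀ v : HeightOneSpectrum (𝓞 F), v.valuation F a ≤ 1) →
    (∀ v : HeightOneSpectrum (𝓞 F), v.valuation F a⁻¹ ≤ 1) →
    (∀ v : HeightOneSpectrum (𝓞 F), v.valuation F (a - 1) ≤ idealRadius F v 𝔫) → a = 1)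
  (t : Fin 2 → (FiniteAdeleRing (𝓞 F) F)ˣ) {c : FiniteAdelicGL 2 F}
  (hc : c ∈ glFiniteIntegralLevel 2 F)
  {X : Type*} (s : X → borel F)
  (hs01 : ∀ x, ((s x : GL (Fin 2) F) : Matrix (Fin 2) (Fin 2) F) 0 1 = 0)
  (hsΛ : ∀ x, ∀ γ ∈ borelStabilizer 𝔫 t c, (s x)⁻¹ * γ * s x ∈ borelStabilizer 𝔫 t c)

/-- `V_wt` as a representation of `B(F)`. [folklore] -/
abbrev borelCoeffRep : Representation E (borel F) (CoeffModule E F 2 wt) :=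
  (coeffRep E F 2 wt).comp (borel F).subtype

/-- The ambient tensor representation restricted to `B(F)`. [folklore] -/
abbrev borelAmbientRep : Representation E (borel F) (TensorAmbient E F (coeffDegree wt)) :=
  (ambientRep E F (coeffDegree wt) (lowestEntry wt)).comp (borel F).subtype

/-- `V_wt|_{B(F)}` in Mathlib's `Rep`. [folklore] -/
abbrev coeffRepB : Rep E (borel F) := Rep.of (borelCoeffRep E wt)

/-- `𝕋|_{B(F)}` in Mathlib's `Rep`. [folklore] -/
abbrev ambientRepB : Rep E (borel F) :=
  Rep.of (X := ModuleCat.of E (TensorAmbient E F (coeffDegree wt))) (borelAmbientRep E wt)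

/-- The conjugations `c_x = (λ ↦ s_x⁻¹ λ s_x) : Λ →* Λ`. [folklore] -/
abbrev torusConj (x : X) : borelStabilizer 𝔫 t c →* borelStabilizer 𝔫 t c :=
  subgroupConj (borelStabilizer 𝔫 t c) (s x) (hsΛ x)

/-- The pair maps `ρ(s_x)` on `V_wt|_Λ`. [folklore] -/
abbrev coeffPair (x : X) :
    Rep.res (torusConj t s hsΛ x) (resSub (borelStabilizer 𝔫 t c) (coeffRepB E wt)) ⟶
      resSub (borelStabilizer 𝔫 t c) (coeffRepB E wt) :=
  resConj (borelStabilizer 𝔫 t c) (coeffRepB E wt) (s x) (hsΛ x)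

/-- The pair maps `ρ_𝕋(s_x)` on `𝕋|_Λ`. [folklore] -/
abbrev ambientPair (x : X) :
    Rep.res (torusConj t s hsΛ x) (resSub (borelStabilizer 𝔫 t c) (ambientRepB E wt)) ⟶
      resSub (borelStabilizer 𝔫 t c) (ambientRepB E wt) :=
  resConj (borelStabilizer 𝔫 t c) (ambientRepB E wt) (s x) (hsΛ x)

/-- **The torus operators `Φ_x = H^q(c_{s_x}, ρ(s_x))` on `H^q(Λ, V_wt)`.** [cite: Harder1987, §2] -/
abbrev torusOp (q : ℕ) (x : X) :
    Module.End E (groupCohomology (resSub (borelStabilizer 𝔫 t c) (coeffRepB E wt)) q) :=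
  (groupCohomology.map (torusConj t s hsΛ x) (coeffPair E wt t s hsΛ x) q).hom

/-- The ratio `b_x / a_x` of the diagonal entries of `s_x = diag(a_x, b_x)`. [folklore] -/
def diagRatio (x : X) : F :=
  ((s x : GL (Fin 2) F) : Matrix (Fin 2) (Fin 2) F) 1 1 / ((s x : GL (Fin 2) F) : Matrix (Fin 2) (Fin 2) F) 0 0

/-- **The algebraic characters** `x ↦ χ_I(s_x) · ∏_τ τ(b_x/a_x)^{p_τ}`, `p_τ ∈ {0, 1}`. [cite: Harder1987, §2] -/
def torusCharSet : Set (X → E) :=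
  {f | ∃ (I : AmbIdx E F (coeffDegree wt)) (p : (F →+* E) → Fin 2),
    f = fun x => ambientChar E F (coeffDegree wt) (lowestEntry wt) I (s x : GL (Fin 2) F) *
      ∏ τ : F →+* E, τ (diagRatio s x) ^ ((p τ : Fin 2) : ℕ)}

/-- The embedding `V_wt ↪ 𝕋` as a morphism of `Λ`-representations. [folklore] -/
def coeffToAmbientHom :
    resSub (borelStabilizer 𝔫 t c) (coeffRepB E wt) ⟶ resSub (borelStabilizer 𝔫 t c) (ambientRepB E wt) :=
  Rep.ofHom (LinearMap.intertwiningMap_of_isIntertwiningMap _ _ (coeffToAmbient E F wt) fun γ v =>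
    coeffToAmbient_coeffRep E F wt (((γ : borel F) : GL (Fin 2) F)) v)

omit [CharZero E] [IsAlgClosed E] in
/-- Unfolding `coeffToAmbientHom`. [folklore] -/
@[simp]
theorem coeffToAmbientHom_hom_apply (v : CoeffModule E F 2 wt) :
    (coeffToAmbientHom E wt t (𝔫 := 𝔫) (c := c)).hom v = coeffToAmbient E F wt v := rfl

include hneat hc hs01 in
/-- **The torus operators are scalar-filtered by algebraic characters.** [cite: Harder1987, §2, (2.4)–(2.7)] -/
theorem scalarFiltered_torus (hF : Module.finrank ℚ F = 2) (h𝔫 : 𝔫 ≠ 0) (q : ℕ) :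
    ScalarFiltered (torusOp E wt t s hsΛ q) (torusCharSet E wt s) ⊤ := by
  classical
  set Λ := borelStabilizer 𝔫 t c with hΛ
  set d := coeffDegree wt with hd
  set m := lowestEntry wt with hm
  have hj : Function.Injective (coeffToAmbientHom E wt t (𝔫 := 𝔫) (c := c)).hom := coeffToAmbient_injective E F wt
  have hjψ : ∀ x b, (coeffToAmbientHom E wt t (𝔫 := 𝔫) (c := c)).hom ((coeffPair E wt t s hsΛ x).hom b) =
      (ambientPair E wt t s hsΛ x).hom ((coeffToAmbientHom E wt t (𝔫 := 𝔫) (c := c)).hom b) := fun x b =>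
    coeffToAmbient_coeffRep E F wt ((s x : borel F) : GL (Fin 2) F) b
  -- the diagonal entries of `s x`
  have hsdiag : ∀ x (a b : Fin 2), a ≠ b → ((s x : GL (Fin 2) F) : Matrix (Fin 2) (Fin 2) F) a b = 0 := by
    intro x a b hab
    fin_cases a <;> fin_cases b
    · exact absurd rfl hab
    · exact hs01 x
    · exact (mem_borel_iff _).1 (s x).2
    · exact absurd rfl hab
  -- the characters `χ_I`
  set χ : AmbIdx E F d → X → E := fun I x => ambientChar E F d m I (s x : GL (Fin 2) F) with hχ
  refine scalarFiltered_of_injective_hom (torusConj t s hsΛ) (ambientPair E wt t s hsΛ) (torusCharSet E wt s)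
    (coeffPair E wt t s hsΛ) (coeffToAmbientHom E wt t) hj hjψ q ?_
  refine scalarFiltered_sub_of_ambient (torusConj t s hsΛ) (ambientPair E wt t s hsΛ) (torusCharSet E wt s)
    (ambientBasis E F d) (ambRank E F d) (fun g I => ?_) χ (fun x I => ?_) _ (range_stable (coeffToAmbientHom E wt t))
    (range_stableφ (torusConj t s hsΛ) (ambientPair E wt t s hsΛ) (coeffPair E wt t s hsΛ) (coeffToAmbientHom E wt t) hjψ)
    (ambRank_injective E F d) (fun I n => ?_) ?_ q
  · -- unipotent `Λ` acts unitriangularly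
    obtain ⟨hγ, -⟩ := coe_eq_upperRightHom_of_mem_borelStabilizer hneat t hc g
    have h00 : ((((g : borel F) : GL (Fin 2) F)) : Matrix (Fin 2) (Fin 2) F) 0 0 = 1 := by
      rw [hγ]; simp [Matrix.GeneralLinearGroup.upperRightHom_apply]
    have h11 : ((((g : borel F) : GL (Fin 2) F)) : Matrix (Fin 2) (Fin 2) F) 1 1 = 1 := by
      rw [hγ]; simp [Matrix.GeneralLinearGroup.upperRightHom_apply]
    have h10 : ((((g : borel F) : GL (Fin 2) F)) : Matrix (Fin 2) (Fin 2) F) 1 0 = 0 := by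
      rw [hγ]; simp [Matrix.GeneralLinearGroup.upperRightHom_apply]
    exact ambientRep_basis_sub_mem_span_of_unipotent E F d m _ h00 h11 h10 I
  · -- the torus acts diagonally
    have h := ambientRep_basis_of_isDiag E F d m (s x : GL (Fin 2) F) (hsdiag x) I
    change ambientRep E F d m (s x : GL (Fin 2) F) (ambientBasis E F d I) - χ I x • ambientBasis E F d I ∈ _
    rw [h, sub_self]
    exact Submodule.zero_mem _
  · -- the graded pieces `Hⁿ(Λ, E)`: `RankTwoLatticeCohomologyCharacters`
    obtain ⟨B₀, B₁, hgen, hind⟩ := exists_rankTwo_generators_borelStabilizer hF h𝔫 hneat t hc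
    have hcomm : ∀ a b : Λ, a * b = b * a := borelStabilizer_comm hneat t hc
    -- the two embeddings
    have hcard : Nat.card (F →+* E) = 2 := by
      rw [Nat.card_eq_fintype_card, NumberField.Embeddings.card, hF]
    obtain ⟨τ₁, τ₂, hτ, huniv⟩ := Nat.card_eq_two_iff.1 hcard
    have hall : ∀ τ : F →+* E, τ = τ₁ ∨ τ = τ₂ := fun τ => by
      have : τ ∈ ({τ₁, τ₂} : Set (F →+* E)) := by rw [huniv]; trivial
      simpa using this
    have huniv' : (Finset.univ : Finset (F →+* E)) = {τ₁, τ₂} := by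
      ext τ
      simp only [Finset.mem_univ, Finset.mem_insert, Finset.mem_singleton, true_iff]
      exact hall τ
    set θ₁ := thetaChar hneat t hc τ₁ with hθ₁
    set θ₂ := thetaChar hneat t hc τ₂ with hθ₂
    set e₁ : X → E := fun x => τ₁ (diagRatio s x) with he₁def
    set e₂ : X → E := fun x => τ₂ (diagRatio s x) with he₂def
    have he₁ : ∀ x (γ : Λ), θ₁ (Additive.ofMul (torusConj t s hsΛ x γ)) = e₁ x * θ₁ (Additive.ofMul γ) := fun x γ =>
      thetaChar_subgroupConj hneat t hc τ₁ (s x) (hs01 x) (hsΛ x) γ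
    have he₂ : ∀ x (γ : Λ), θ₂ (Additive.ofMul (torusConj t s hsΛ x γ)) = e₂ x * θ₂ (Additive.ofMul γ) := fun x γ =>
      thetaChar_subgroupConj hneat t hc τ₂ (s x) (hs01 x) (hsΛ x) γ
    have hindep : ∀ a b : E, (∀ γ : Λ, a * θ₁ (Additive.ofMul γ) + b * θ₂ (Additive.ofMul γ) = 0) → a = 0 ∧ b = 0 :=
      thetaChar_indep hneat t hc hF h𝔫 hτ
    -- membership of the four character families in `torusCharSet`
    have mem : ∀ p : (F →+* E) → Fin 2, (fun x => χ I x * ∏ τ : F →+* E, τ (diagRatio s x) ^ ((p τ : Fin 2) : ℕ)) ∈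
        torusCharSet E wt s := fun p => ⟨I, p, rfl⟩
    have prod_p : ∀ (p : (F →+* E) → Fin 2) (x : X), ∏ τ : F →+* E, τ (diagRatio s x) ^ ((p τ : Fin 2) : ℕ) =
        τ₁ (diagRatio s x) ^ ((p τ₁ : Fin 2) : ℕ) * τ₂ (diagRatio s x) ^ ((p τ₂ : Fin 2) : ℕ) := fun p x => by
      rw [huniv', Finset.prod_pair hτ]
    rcases n with _ | _ | _ | n
    · -- `H⁰`: character `χ_I`
      refine (scalarFiltered_H0ₛ (torusConj t s hsΛ) (χ I)).mono ?_
      rintro f rfl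
      convert mem (fun _ => 0) using 1
      funext x
      rw [prod_p]
      simp
    · -- `H¹`: characters `χ_I τᵢ(b/a)`
      refine (scalarFiltered_H1ₛ B₀ B₁ hgen θ₁ θ₂ hindep (torusConj t s hsΛ) e₁ e₂ he₁ he₂ (χ I)).mono ?_
      rintro f hf
      rcases hf with rfl | rfl
      · convert mem (fun τ => if τ = τ₁ then 1 else 0) using 1
        funext x
        rw [prod_p]
        simp [hτ.symm, he₁def]
      · convert mem (fun τ => if τ = τ₂ then 1 else 0) using 1
        funext x
        rw [prod_p]
        simp [hτ, he₂def]
    · -- `H²`: character `χ_I τ₁τ₂(b/a)`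
      refine (scalarFiltered_H2ₛ B₀ B₁ hcomm hgen hind θ₁ θ₂ hindep (torusConj t s hsΛ) e₁ e₂ he₁ he₂ (χ I)).mono ?_
      rintro f rfl
      convert mem (fun _ => 1) using 1
      funext x
      rw [prod_p]
      simp [he₁def, he₂def]
    · -- `Hⁿ = 0`, `n ≥ 3`
      exact scalarFiltered_of_three_leₛ B₀ B₁ hcomm hgen hind (torusConj t s hsΛ) (χ I) _ n
  · -- `V_wt ⊆ 𝕋 = span w`
    rw [span_range_ambientBasis]
    exact le_top

include hneat hc hs01 in
/-- **The eigencharacter of a common eigenvector of the torus operators on `H^q(Λ, V_wt)` is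
algebraic**: `M(x) = χ_I(s_x) ∏_τ τ(b_x/a_x)^{p_τ}` for some `I` and `p_τ ∈ {0, 1}`.
[cite: Harder1987, §2, (2.4)–(2.7)] -/
theorem exists_torus_eigencharacter (hF : Module.finrank ℚ F = 2) (h𝔫 : 𝔫 ≠ 0) (q : ℕ)
    {z : groupCohomology (resSub (borelStabilizer 𝔫 t c) (coeffRepB E wt)) q} (hz : z ≠ 0)
    (M : X → E) (heig : ∀ x, torusOp E wt t s hsΛ q x z = M x • z) :
    ∃ (I : AmbIdx E F (coeffDegree wt)) (p : (F →+* E) → Fin 2), ∀ x,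
      M x = ambientChar E F (coeffDegree wt) (lowestEntry wt) I (s x : GL (Fin 2) F) *
        ∏ τ : F →+* E, τ (diagRatio s x) ^ ((p τ : Fin 2) : ℕ) := by
  obtain ⟨ω, ⟨I, p, rfl⟩, hω⟩ :=
    (scalarFiltered_torus E wt hneat t hc s hs01 hsΛ hF h𝔫 q).exists_eq_of_eigenvector_top hz M heig
  exact ⟨I, p, hω⟩

include hneat hc hs01 in
/-- The same for a subgroup `Λ` *equal* to the stabiliser lattice (the form produced by the
orbit stabilisers of the Borel model, `HeckeOrbitConjugation`). [cite: Harder1987, §2, (2.4)–(2.7)] -/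
theorem exists_torus_eigencharacter_of_eq (hF : Module.finrank ℚ F = 2) (h𝔫 : 𝔫 ≠ 0) (q : ℕ)
    {Λ : Subgroup (borel F)} (hΛ : Λ = borelStabilizer 𝔫 t c)
    (hsΛ' : ∀ x, ∀ γ ∈ Λ, (s x)⁻¹ * γ * s x ∈ Λ)
    {z : groupCohomology (resSub Λ (coeffRepB E wt)) q} (hz : z ≠ 0) (M : X → E)
    (heig : ∀ x, (groupCohomology.map (subgroupConj Λ (s x) (hsΛ' x))
      (resConj Λ (coeffRepB E wt) (s x) (hsΛ' x)) q).hom z = M x • z) :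
    ∃ (I : AmbIdx E F (coeffDegree wt)) (p : (F →+* E) → Fin 2), ∀ x,
      M x = ambientChar E F (coeffDegree wt) (lowestEntry wt) I (s x : GL (Fin 2) F) *
        ∏ τ : F →+* E, τ (diagRatio s x) ^ ((p τ : Fin 2) : ℕ) := by
  subst hΛ
  exact exists_torus_eigencharacter E wt hneat t hc s hs01 hsΛ' hF h𝔫 q hz M heig

end Torus

end Literature.NumberTheory.Automorphic.ParallelWeight
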